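import Summits.CriticalPhenomena.PercolationContinuityZ3.Theorems.PercNearOneGluingAdditiveGluingK0CovTransferQ
import Summits.CriticalPhenomena.PercolationContinuityZ3.Theorems.PercNearOneGluingAdditiveGluingK0CovTransferPOfQ
import Summits.CriticalPhenomena.PercolationContinuityZ3.Theorems.PercNearOneGluingAdditiveGluingK0AttachTransferD
import HarnessLib

/-!
# Crux `PercNearOneGluing.AdditiveGluing` (stmt-CriticalPhenomena-4576), line `tieline`: the covariance transfer for `P`
# (registered stub `stub_k0CovTransferP_c9` = (α)), PROVED

Stub landing (`--supports stmt-CriticalPhenomena-4576`; seat (d) exchange-certificate form, gen 12).  No definitions, no named facts, no sorries.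
(α) `μ(D∩v↔b)·(a_o μ(N) − a_c μ(NJ)) ≤ μ(D)·(P_o μ(N) − P_c μ(NJ))` (`D = {u↮v}`, `N = {c↮u}∩{c↮v}`, `a_x = μ(D∩v↔x)`,
`P_x = μ(D∩v↔b∩x↮u)`) is the lead's reduction `k0CovTransferP_of_Q` ((α) ⟸ (β) with the relays swapped + (γ'')) fed with the now PROVED
(β) = (T) = `TieLine.stub_k0CovTransferQ_c9` (p205120) and the landed (γ'') = `stub_k0AttachTransferD_c10`.
[cite: KozmaNitzan2024, Lemma 4 (p. 9), Question 7 (p. 36)] [cite: VandenbergHaggstromKahn2005, Thms. 1.3–1.5, §2.1] [cite: Gladkov2024, Thm. 3.2]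
-/

namespace Summit.CriticalPhenomena.PercolationContinuityZ3.Cruxes.AdditiveGluing.TieLine

open MeasureTheory Set Literature.Probability.LatticeModels Literature.Probability.Percolation

noncomputable section

/-- **Stub (α) = `stub_k0CovTransferP_c9`, PROVED** (registered signature verbatim): the covariance transfer for `P`.
`k0CovTransferP_of_Q stub_k0CovTransferQ_c9 stub_k0AttachTransferD_c10`. [cite: KozmaNitzan2024, Question 7 (p. 36)]
[cite: VandenbergHaggstromKahn2005, Thm. 1.5 (p. 7), §2.1 (pp. 9–13)] -/
theorem stub_k0CovTransferP_c9 : ∀ (n : ℕ) (w : Sym2 (Fin n) → unitInterval) (o b u v c : Fin n), (Literature.Probability.LatticeModels.prodBernoulli w).real ((Literature.Probability.Percolation.openConn u v)ᶜ ∩ Literature.Probability.Percolation.openConn v b : Set (Literature.Probability.Percolation.BondConfig (Fin n))) * ((Literature.Probability.LatticeModels.prodBernoulli w).real ((Literature.Probability.Percolation.openConn u v)ᶜ ∩ Literature.Probability.Percolation.openConn v o : Set (Literature.Probability.Percolation.BondConfig (Fin n))) * (Literature.Probability.LatticeModels.prodBernoulli w).real ((Literature.Probability.Percolation.openConn c u)ᶜ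 ∩ (Literature.Probability.Percolation.openConn c v)ᶜ : Set (Literature.Probability.Percolation.BondConfig (Fin n))) - (Literature.Probability.LatticeModels.prodBernoulli w).real ((Literature.Probability.Percolation.openConn u v)ᶜ ∩ Literature.Probability.Percolation.openConn v c : Set (Literature.Probability.Percolation.BondConfig (Fin n))) * (Literature.Probability.LatticeModels.prodBernoulli w).real ((Literature.Probability.Percolation.openConn c u)ᶜ ∩ (Literature.Probability.Percolation.openConn c v)ᶜ ∩ Literature.Probability.Percolation.openConn o c : Set (Literature.Probability.Percolation.BondConfig (Fin n)))) ≤ (Literature.Probability.LatticeModels.prodBernoulli w).real ((Literature.Probability.Percolation.openConn u v)ᶜ : Set (Literature.Probability.Percolation.BondConfig (Fin n))) * ((Literature.Probability.LatticeModels.prodBernoulli w).real ((Literature.Probability.Percolation.openConn u v)ᶜ ∩ Literature.Probability.Percolation.openConn v b ∩ (Literature.Probability.Percolation.openConn o u)ᶜ : Set (Literature.Probability.Percolation.BondConfig (Fin n))) * (Literature.Probability.LatticeModels.prodBernoulli w).real ((Literature.Probability.Percolation.openConn c u)ᶜ ∩ (Literature.Probability.Percolation.openConn c v)ᶜ : Set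 (Literature.Probability.Percolation.BondConfig (Fin n))) - (Literature.Probability.LatticeModels.prodBernoulli w).real ((Literature.Probability.Percolation.openConn u v)ᶜ ∩ Literature.Probability.Percolation.openConn v b ∩ (Literature.Probability.Percolation.openConn c u)ᶜ : Set (Literature.Probability.Percolation.BondConfig (Fin n))) * (Literature.Probability.LatticeModels.prodBernoulli w).real ((Literature.Probability.Percolation.openConn c u)ᶜ ∩ (Literature.Probability.Percolation.openConn c v)ᶜ ∩ Literature.Probability.Percolation.openConn o c : Set (Literature.Probability.Percolation.BondConfig (Fin n)))) :=
  k0CovTransferP_of_Q stub_k0CovTransferQ_c9 stub_k0AttachTransferD_c10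

end

end Summit.CriticalPhenomena.PercolationContinuityZ3.Cruxes.AdditiveGluing.TieLine
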